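import Literature.NumberTheory.Automorphic.TotallyRealModularityLargeImage
import Literature.NumberTheory.Automorphic.TotallyRealModularityProofs
import HarnessLib

/-!
# Box 2022, Theorem 1.3: the residual images at `3`, `5`, `7` of a non-modular elliptic curve over
# a totally real field

Topic `Literature/NumberTheory/Automorphic`; companion of `TotallyRealModularity.lean` (named fact
`Box2022_theorem1_1`, rendering of "modular" = `IsAutomorphicOfWeightZero E`) and of
`TotallyRealModularityLargeImage.lean` (carriers). One named fact (D-0014; users take
`(h : Box2022_theorem1_3)`), vendored by a grounder for route `Langlands/SqrtFiveQuarticCovers`.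

## What the source prints (held text `paper:arxiv-2103.13975`, p. 4)

J. Box, *Elliptic curves over totally real quartic fields not containing `√5` are modular*, Trans.
Amer. Math. Soc. 375 (2022) = arXiv:2103.13975, §1.2: "We denote by `B(p) ⊂ GL₂(𝔽_p)` the Borel
subgroup, by `C_s⁺(p) ⊂ GL₂(𝔽_p)` the normaliser of a split Cartan subgroup, and by `C_ns⁺(p)` the
normaliser of a non-split Cartan subgroup. Finally, we also consider
`G(e7) := ⟨(0 5; 3 0), (5 0; 3 2)⟩ ⊂ GL₂(𝔽₇)`, which is an index 2 subgroup of a `C_ns⁺(7)`.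
**Theorem 1.3.** Suppose that `E` is a non-modular elliptic curve over a totally real field `K`.
Then (i) `Im(ρ̄_{E,3})` is conjugate to a subgroup of `C_s⁺(3)` or `B(3)`, (ii) if `√5 ∉ K`, then
`Im(ρ̄_{E,5})` is conjugate to a subgroup of `B(5)`, and (iii) if `K ∩ ℚ(ζ₇) = ℚ`, then
`Im(ρ̄_{E,7})` is conjugate to a subgroup of `B(7)` or `G(e7)`."  Proof (ibid.): (i) Breuil–Diamond
lifting as in [FLS 2015] + Rubin; (ii) Thorne 2016; (iii) Kalyanswamy 2018 ("if `ζ₇ + ζ₇⁻¹ ∉ K`,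
then `Im(ρ̄_{E,7})` is conjugate to a subgroup of either `B(7)` or `C_ns⁺(7)`") refined to the
index-2 subgroup `G(e7)` by [FLS 2015].

## Rendering

* `E` = an integral Weierstrass model over `𝓞 K` with `Δ(E) ≠ 0`; "non-modular" =
  `¬ IsAutomorphicOfWeightZero E` (the rendering of Box's "modular", module docstring of
  `TotallyRealModularity.lean`).
* "`Im(ρ̄_{E,p})` is conjugate to a subgroup of `G`" = some framing `ρ̄ : Γ_K →ₜ* GL₂(ZMod p)` of
  the Galois action on the geometric `p`-torsion (`WeierstrassCurve.IsTorsionGaloisRep`, all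
  framings being conjugate) takes values in `G`; `B(p)` = upper-triangular (entry `(1,0)` zero);
  `C_s⁺(3) = ⟨diag(1,2), (0 1; 1 0)⟩` (all of the normaliser, order `8`); `G(e7)` by Box's two
  generators. Same renderings as the route file `Summits/Langlands/Langlands/Theses/SqrtFiveQuarticCovers.lean`
  and as `Box2022_theorem1_5_modular` (`TotallyRealModularitySmallImage.lean`).
* "`√5 ∉ K`" = `¬ IsSquare (5 : K)` (as in `Box2022_theorem1_1`); "`K ∩ ℚ(ζ₇) = ℚ`" for a totally
  real `K` = `ℚ(ζ₇)⁺ = ℚ(ζ₇ + ζ₇⁻¹) ⊄ K` (the only totally real subfields of `ℚ(ζ₇)` are `ℚ` and the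
  cubic `ℚ(ζ₇)⁺`) = the minimal polynomial `X³ + X² - 2X - 1` of `ζ₇ + ζ₇⁻¹` has no root in `K`
  (tree: `Box2022.zeta7_add_inv_cubic`, `Box2022.cubic7_ne_zero` — automatic when `3 ∤ [K:ℚ]`,
  `Box2022.zeta7_add_inv_not_mem_range` for quartic `K`).

Grounds the `3`- and `7`-parts of
`Summit.Langlands.Langlands.Theses.SqrtFiveQuarticCovers.ReductionToRefinedLocus` (those parts =
this fact specialised to quartic `K`, where the hypothesis of (iii) is `Box2022.cubic7_ne_zero`);
the `5`-part of that item (`√5 ∈ K`: image in `B(5)`, `H8` or `H12`) is NOT covered by (ii) and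
rests on FLS 2015 Thm. 3 (`FLS2015_theorems3_4`), Prop. 3.1, Lemma 3.2 and Remark (iii) after
Cor. 2.1 of Part 4 of arXiv:1310.7088 (p. 20 of the held text: for `det(G) = {1, 4}` "three
subgroups of `GL₂(𝔽₅)` of orders `6`, `8` and `12`").

## References

* [Box2022] Trans. AMS 375 (2022), doi:10.1090/tran/8557 = arXiv:2103.13975, §1.2, Thm. 1.3 and
  its proof (p. 4 of the held text).
* [FreitasLeHungSiksek2015] Invent. Math. 201 (2015) 159–206, Thms. 3–4, Part 4 Prop. 1.1.
* [Thorne2016] J. Thorne, Math. Ann. 364 (2016) 589–648; [Kalyanswamy2018] S. Kalyanswamy, Math.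
  Res. Lett. 25 (2018) 1285–1304 (inputs of (ii), (iii) as cited by the source).
-/

open scoped NumberField MatrixGroups
open NumberField Literature.NumberTheory.GaloisRepresentations

noncomputable section

namespace Literature.NumberTheory.Automorphic

/-- **Box (2022), Theorem 1.3: residual images of a non-modular elliptic curve over a totally real
field.** "Suppose that `E` is a non-modular elliptic curve over a totally real field `K`. Then
(i) `Im(ρ̄_{E,3})` is conjugate to a subgroup of `C_s⁺(3)` or `B(3)`, (ii) if `√5 ∉ K`, then
`Im(ρ̄_{E,5})` is conjugate to a subgroup of `B(5)`, and (iii) if `K ∩ ℚ(ζ₇) = ℚ`, then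
`Im(ρ̄_{E,7})` is conjugate to a subgroup of `B(7)` or `G(e7)`", `G(e7) = ⟨(0 5; 3 0), (5 0; 3 2)⟩`.
Rendered (module docstring "Rendering"): for `K` a totally real number field and `E / 𝓞 K` with
`Δ(E) ≠ 0` and `¬ IsAutomorphicOfWeightZero E`: (i) some framing `ρ̄₃` of `E[3]`
(`WeierstrassCurve.IsTorsionGaloisRep`) has image in `B(3)` (entry `(1,0)` zero) or in
`C_s⁺(3) = ⟨diag(1,2), (0 1; 1 0)⟩`; (ii) if `¬ IsSquare (5 : K)`, some framing `ρ̄₅` has image in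
`B(5)`; (iii) if `X³ + X² - 2X - 1` (the minimal polynomial of `ζ₇ + ζ₇⁻¹`) has no root in `K`,
some framing `ρ̄₇` has image in `B(7)` or in `G(e7)`. A named fact (D-0014): users take
`(h : Box2022_theorem1_3)`. Grounds the `3`- and `7`-parts of
`Summit.Langlands.Langlands.Theses.SqrtFiveQuarticCovers.ReductionToRefinedLocus`.
[cite: Box2022, Thm. 1.3] -/
def Box2022_theorem1_3 : Prop :=
  ∀ (K : Type) [Field K] [NumberField K] [IsTotallyReal K] (E : WeierstrassCurve (𝓞 K)),
    E.Δ ≠ 0 → ¬ IsAutomorphicOfWeightZero E →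
      (∃ ρ : FramedGaloisRep K (ZMod 3) 2, (E.baseChange K).IsTorsionGaloisRep 3 ρ ∧
        ((∀ σ : Field.absoluteGaloisGroup K,
            ((ρ σ : GL (Fin 2) (ZMod 3)) : Matrix (Fin 2) (Fin 2) (ZMod 3)) 1 0 = 0) ∨
          (∀ σ : Field.absoluteGaloisGroup K, (ρ σ : GL (Fin 2) (ZMod 3)) ∈
            Subgroup.closure ({(⟨!![1, 0; 0, 2], !![1, 0; 0, 2], by decide, by decide⟩ :
                GL (Fin 2) (ZMod 3)),
              (⟨!![0, 1; 1, 0], !![0, 1; 1, 0], by decide, by decide⟩ : GL (Fin 2) (ZMod 3))} :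
              Set (GL (Fin 2) (ZMod 3)))))) ∧
      (¬ IsSquare (5 : K) →
        ∃ ρ : FramedGaloisRep K (ZMod 5) 2, (E.baseChange K).IsTorsionGaloisRep 5 ρ ∧
          ∀ σ : Field.absoluteGaloisGroup K,
            ((ρ σ : GL (Fin 2) (ZMod 5)) : Matrix (Fin 2) (Fin 2) (ZMod 5)) 1 0 = 0) ∧
      ((∀ x : K, x ^ 3 + x ^ 2 - 2 * x - 1 ≠ 0) →
        ∃ ρ : FramedGaloisRep K (ZMod 7) 2, (E.baseChange K).IsTorsionGaloisRep 7 ρ ∧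
          ((∀ σ : Field.absoluteGaloisGroup K,
              ((ρ σ : GL (Fin 2) (ZMod 7)) : Matrix (Fin 2) (Fin 2) (ZMod 7)) 1 0 = 0) ∨
            (∀ σ : Field.absoluteGaloisGroup K, (ρ σ : GL (Fin 2) (ZMod 7)) ∈
              Subgroup.closure ({(⟨!![0, 5; 3, 0], !![0, 5; 3, 0], by decide, by decide⟩ :
                  GL (Fin 2) (ZMod 7)),
                (⟨!![5, 0; 3, 2], !![3, 0; 6, 4], by decide, by decide⟩ : GL (Fin 2) (ZMod 7))} :
                Set (GL (Fin 2) (ZMod 7))))))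

/-- **Thm. 1.3 (i) and (iii) for quartic fields** (bookkeeping): over a totally real QUARTIC field
the hypothesis of (iii) is automatic (`Box2022.cubic7_ne_zero`, `3 ∤ 4`), so a non-modular `E`
has mod-`3` image in `B(3)` or `C_s⁺(3)` and mod-`7` image in `B(7)` or `G(e7)` for suitable
framings. [cite: Box2022, Thm. 1.3 (i), (iii) and proof of Thm. 1.2] -/
theorem Box2022_theorem1_3.quartic (h : Box2022_theorem1_3) (K : Type) [Field K] [NumberField K]
    [IsTotallyReal K] (hd : Module.finrank ℚ K = 4) {E : WeierstrassCurve (𝓞 K)} (hE : E.Δ ≠ 0)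
    (hne : ¬ IsAutomorphicOfWeightZero E) :
    (∃ ρ : FramedGaloisRep K (ZMod 3) 2, (E.baseChange K).IsTorsionGaloisRep 3 ρ ∧
        ((∀ σ : Field.absoluteGaloisGroup K,
            ((ρ σ : GL (Fin 2) (ZMod 3)) : Matrix (Fin 2) (Fin 2) (ZMod 3)) 1 0 = 0) ∨
          (∀ σ : Field.absoluteGaloisGroup K, (ρ σ : GL (Fin 2) (ZMod 3)) ∈
            Subgroup.closure ({(⟨!![1, 0; 0, 2], !![1, 0; 0, 2], by decide, by decide⟩ :
                GL (Fin 2) (ZMod 3)),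
              (⟨!![0, 1; 1, 0], !![0, 1; 1, 0], by decide, by decide⟩ : GL (Fin 2) (ZMod 3))} :
              Set (GL (Fin 2) (ZMod 3)))))) ∧
      ∃ ρ : FramedGaloisRep K (ZMod 7) 2, (E.baseChange K).IsTorsionGaloisRep 7 ρ ∧
        ((∀ σ : Field.absoluteGaloisGroup K,
            ((ρ σ : GL (Fin 2) (ZMod 7)) : Matrix (Fin 2) (Fin 2) (ZMod 7)) 1 0 = 0) ∨
          (∀ σ : Field.absoluteGaloisGroup K, (ρ σ : GL (Fin 2) (ZMod 7)) ∈
            Subgroup.closure ({(⟨!![0, 5; 3, 0], !![0, 5; 3, 0], by decide, by decide⟩ :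
                GL (Fin 2) (ZMod 7)),
              (⟨!![5, 0; 3, 2], !![3, 0; 6, 4], by decide, by decide⟩ : GL (Fin 2) (ZMod 7))} :
              Set (GL (Fin 2) (ZMod 7))))) := by
  obtain ⟨h3, -, h7⟩ := h K E hE hne
  have h3' : ¬ 3 ∣ Module.finrank ℚ K := by rw [hd]; decide
  exact ⟨h3, h7 fun x => Box2022.cubic7_ne_zero h3' x⟩

end Literature.NumberTheory.Automorphic

end
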